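import Summits.BirchSwinnertonDyer.BirchSwinnertonDyer.Theorems.PrintX11aUpperNonSurjFiveThreeCores
import Summits.BirchSwinnertonDyer.BirchSwinnertonDyer.Theorems.PrintX11aUpperNonSurjFiveExcCore
import Literature.NumberTheory.EllipticCurves.ModularityVersionApProofs
import Literature.NumberTheory.EllipticCurves.AnalyticRankOrderProofs
import Literature.NumberTheory.EllipticCurves.AnalyticRankModularityProofs
import Literature.NumberTheory.EllipticCurves.CuspFormLFunctionLevelConductorProofs
import Literature.NumberTheory.EllipticCurves.LFunctionPrimeCoeffMultiplicative
import Literature.FieldTheory.AlgClosed.PadicAlgClEquivComplex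
import Literature.NumberTheory.EllipticCurves.CanonicalPeriodSymbolCongruence
import Literature.NumberTheory.EllipticCurves.ModularCurveIharaLemma
import Literature.NumberTheory.EllipticCurves.StabilisedLevelLoweringCongruence
import Summits.BirchSwinnertonDyer.Rank1Residual.Additive.PlusSymbolIntegrality
import HarnessLib

/-!
# Line «llzero5» (REV 4) — crux `Theses.PrintX11a.UpperNonSurjFive` (item stmt-BirchSwinnertonDyer-20614), lens «decomp»

Seat bsd-idea-6 g11 (planner-bsd-idea-6-g11-0), 2026-08-28.  PUBLISHED ONLY (W-79): the line of record stays «gl1cartan5»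
(rev 10, lead `cruxlead-stmt-BirchSwinnertonDyer-20614`); this file is NOT passed to `ledger skeleton check`.  BSD is not proved by
any of this; no summit statement is proved here; the crux does NOT close (five `sorry`s since REV 4, all inside `stub_*`).

## Idea (one lever)

The only census-populated OPEN core of the record's rev-10 cut is the EXCEPTIONAL core C_exc («`p` split multiplicative»,
`GL1Cartan.ExcZeroCoreResidual`; 23 of the 56 known pairs at `p = 5`, `CORES-CENSUS-cruxlead-g5.md`).  On an X11a pair with
`ρ̄_{E,p}` NOT surjective and `p` split multiplicative, `E[p]` is finite flat at `p` (`p ∣ v_p(Δ) = c_p`: otherwise inertia at `p`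
gives a transvection and, `E[p]` being irreducible, `ρ̄` is surjective) and unramified at every other multiplicative prime (X11a:
`¬ Ram`).  So `ρ̄` is modular of level prime to `p` (Ribet ∕ Diamond 1995, tree fact `diamond1995_refinedSerre`), and at level
`N = N_E` the newform `f = f_E` (`a_p(f) = +1`, «𝔪 ordinary») is congruent to the `p`-STABILISED level-lowered eigenform `g`
(`U_p g = α_g g`, `α_g ≡ a_p(f) = 1 (mod 𝔭)`).  Greenberg–Vatsal's canonical-period congruence AT A MULTIPLICATIVE `p`
(tree fact `greenbergVatsal2000_plusSymbol_congruence`, second bullet: `p ∥ M` allowed when `𝔪` is ordinary) gives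
`[x]⁺_f/Ω_f ≡ [x]⁺_g/Ω_g (mod 𝔭)` for all `x`, and the `p`-old shape `[x]⁺_g = Φ(x) − α_g⁻¹ Φ(p·x)` evaluated AT THE CUSP `x = 0`
reads `[0]⁺_g = (1 − α_g⁻¹)·Φ(0) ≡ 0`: the exceptional-zero factor `(1 − α⁻¹)`, which kills `L_p(E,0)` (barrier `ExceptionalZero`),
reappears one level down as a CONGRUENCE and pays the Tamagawa `p` — «`p ∣ L(E,1)/Ω_E` at every anomalous-split level-lowering
prime».  REV 3 (critic V#132, sharpening S1, refined here to S1′): lowering at `p` AND at every other multiplicative prime (all of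
them unramified by `¬ Ram` and NON-SPLIT on the shallow locus `ord_p ∏ c ≤ 1`) reaches Ribet's OPTIMAL level `N(ρ̄) = N_add`, where the
newform `g₀` has root number `w(g₀) = −w(E) = −1` (only the split `p` flips the sign), hence `L(g₀,1) = 0` and the fully stabilised `g` has
`[0]_g = ∏(1 − γ̃_q/q)·[0]_{g₀} = 0` EXACTLY — no Ihara ∕ `Φ/Ω_g`-integrality, no Steinberg-sign caveat — so the key K1♭ `ShallowExcSymbolZero`
(`1 ≤ ord_p [0]⁺_f` on the shallow split locus) is a COMPOSITE OF NAMED PRINT (research-S/M, transcription) and no longer «beyond print».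
The stronger all-`x` form K1ᴸ (`IsStabilisedLevelLoweringCongruenceIn W p 1 f q π` AT `q = p`, REV 2's key) and its consequence K1 on the
full split locus stay in the file as an ASIDE road (real proof K1ᴸ ⟹ K1 ⟹ K1♭).
With K1♭, the EXC-SHALLOW sector («`p` split, `Ш(E)[p] = 0`, `ord_p ∏ c ≤ 1`»; 21 of the 23 C_exc census pairs) closes EXACTLY like the
record's SHALLOW sector (`ord_p #Ш_an = ord_p (L/Ω) − ord_p ∏ c ≥ 1 − 1 = 0` + the door `ClassX11a.missingUpperBoundAt_of_noPTorsion`),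
and the two remaining cores become `p`-TYPE-FREE: C_exp^± («`Ш[p] ≠ 0`»; hard value asked at non-split `p` only) and C_tam^± («`Ш[p] = 0`,
`ord_p ∏ c ≥ 2`»; same), each U5 verbatim on a sub-locus and each implied by the record's three cores (`rCores_of_threeCores`: the line asks
NO MORE of the future than rev 10).  DECOMP CONTENT: U5 = UNIT ⊔ SHALLOW ⊔ EXC-SHALLOW (closed mod K1♭ = named print) ⊔ C_exp^± ⊔ C_tam^± —
i.e. modulo transcription the wall of U5 is literally «`Ш(E)[p] ≠ 0` or `ord_p ∏ c ≥ 2`», for both `p`-types (census at `p = 5`: 15 + 2 pairs).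

REV 4 (same session, after reading the LEAD g6's landed EXCEPTIONAL-ZERO road `Theorems/PrintX11aUpperNonSurjFiveExc{Toolkit,ToolkitRoots,Core,
Period,PeriodCycle,Ihara,MultiStab,CoreCycle}.lean`, 00:05–00:24Z, which formalises the REV-1 plan of THIS line at a general `p` through step (f)):
K1♭ is now DERIVED IN THE KERNEL from the new key K1♯ `VanishingPartnerAtSplitP` (the S1′ partner `g` at level `N`: eigenform, normalised,
number-field integral coefficients, Condition 1 in characteristic 0, congruent to `f` at every index, `plusSymbol g 0 = 0`) plus Greenberg–Vatsal
BY NAME — real theorem `shallowExcSymbolZero_of_vanishingPartner`, which calls the lead's landed core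
`Theorems.GL1Cartan.Exc.one_le_padicValRat_ratPlusSymbol_zero_of_symbolCongruence` with the DEGENERATE old shape `q = 0`, `c = 1`, `Φ = plusSymbol g`,
`Ω = Ω_g` (legal exactly because `plusSymbol g 0 = 0`).  READING FOR THE LEAD: on the shallow locus the S1′ vanishing replaces the four inputs
`hshape ∕ hc ∕ hΩint ∕ hΩunit` of the lead's wrapper `…_of_greenbergVatsal` — i.e. Theorem D″ (Ihara, `ExcIhara`), the period producer
(`ExcPeriod`, `ExcPeriodCycle`) and the stabilisation-constant bookkeeping `c ≡ 1` are NOT needed for the value at the cusp `0`; what remains is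
the EXISTENCE of the partner (Ribet optimal level + sign flip + `ExcMultiStab`-type stabilisation data + Condition 1).

## Registered shape (REV 4: 5 stubs; `sorry` only inside `stub_*`)

* `stub_nineFacts : NineFacts` — the nine print facts of the record's glue, BY NAME (one conjunction, as in «sqparity5»).
* `stub_greenbergVatsal : greenbergVatsal2000_plusSymbol_congruence` — the tree's named Literature fact, BY NAME (as in the lead's road).
* `stub_vanishingPartnerAtSplitP : VanishingPartnerAtSplitP` — K1♯, the KEY (REV 4; research-S/M: COMPOSITE OF NAMED PRINT via S1′ (i)–(iv), see
  its docstring): the vanishing partner on «X11a, `¬ Surj`, `5 ≤ p`, `p` split, `ord_p ∏ c ≤ 1`».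
* `stub_exponentCoreR : ExponentCoreR`, `stub_deepTamagawaCoreR : DeepTamagawaCoreR` — residuals (U5 verbatim, restricted; datum-free; the hard-value
  clause asked at non-split `p` only).
* REAL proofs: `shallowExcSymbolZero_of_vanishingPartner` (GV + K1♯ ⟹ K1♭ through the lead's core; REV 4), `excSymbolZero_of_levelLowering` (ASIDE
  road: K1ᴸ ⟹ K1, reading (LL₁) at the cusp `0`), `shallowExcSymbolZero_of_excSymbolZero`, `shallowExcValueDivisibility_of_symbolZero` (K1♭ ⟹
  `1 ≤ ord_p (L(E,1)/Ω_E)`, via Mazur Cor. 4.1 + GV Rem. 3.4 period comparison, tree theorem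
  `SkinnerUrban2014.realPeriodRat_eq_unit_mul_plusPeriod_of_multiplicative_of_mazur`), `excShallowSector_of_valueDivisibility`, `excZeroCore_of_parts`
  (C_exc from EXC-SHALLOW + the two ± cores), `rCores_of_threeCores` / `parts_of_upperNonSurjFive` (comparison with rev 10, fact-free),
  `UpperNonSurjFive_of_hyps`, `UpperNonSurjFive_of_hyps_LL` (the aside road), `UpperNonSurjFive_of_hyps_partner` (REV 4 road), and the composition
  `UpperNonSurjFive_of_llzero : Theses.PrintX11a.UpperNonSurjFive` through the landed turnkey `Theorems.GL1Cartan.upperNonSurjFive_of_nineFacts_of_threeCores` (p677750).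

References: [GreenbergVatsal2000] §3 (17)–(19), Prop. (3.1), Rem. (3.4), Lemma before §4 (arXiv p. 38: canonical periods of the
`p`-stabilised oldform = Néron periods at multiplicative `p`, via Wiles 1995 Lemma 2.2); [Vatsal1999] (1.6), Thm. (1.13) both bullets;
[Ribet1990] Thm. 1.1 / [Diamond1995RefinedSerre] Thm. 1.1; [Serre1987] §2.8, §4; [Carayol1989]; [Deligne1973Constantes] §6 (local constants
modulo `ℓ`); [Ribet1984] Ihara's lemma (tree fact `ribet1984_iharaLemma`, any residue
characteristic); [ColemanEdixhoven1998] Thm. 4.1 (`U_p` semisimple on `p`-old forms of weight 2); [Mazur1978] Cor. 4.1;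
[SilvermanATAEC1994] Cor. IV.9.2 (d); [Miller2011LMS] Def. 1.1.
-/

set_option linter.dupNamespace false
set_option autoImplicit false

noncomputable section

open scoped Classical NumberField MatrixGroups ModularForm

open CongruenceSubgroup WeierstrassCurve
  Literature.NumberTheory.EllipticCurves
  Literature.NumberTheory.EllipticCurves.ModularForms
  Literature.NumberTheory.EllipticCurves.Rank1Residual
  Literature.NumberTheory.EllipticCurves.Rank1Residual.Typed
  Literature.NumberTheory.EllipticCurves.Wuthrich2014
  Summit.BirchSwinnertonDyer.Rank1Residual
  Summit.BirchSwinnertonDyer.BirchSwinnertonDyer.Theses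
  Summit.BirchSwinnertonDyer.BirchSwinnertonDyer.Theorems.GL1Cartan

open Literature.NumberTheory.DiophantineGeometry.Dioph (ratModP)

namespace Summit.BirchSwinnertonDyer.BirchSwinnertonDyer.Cruxes.UpperNonSurjFive.LLZero

/-! ## §1 Statements -/

/-- **K1ᴸ — `LevelLoweringAtSplitP` (ASIDE since REV 3 — the STRONGER all-`x` form in the bsd-addord currency (LL₁) AT `q = p`; it was the key stub of
REV 2; not in the cone of the composition any more, kept with its real consequence K1 as the research-grade strengthening).**  For minimal `E/ℚ` in class X11a at a
prime `p ≥ 5` of SPLIT multiplicative reduction with `ρ̄_{E,p}` not surjective, and `f` the newform of `E`: the stabilised level-lowering congruence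
of depth `1` holds AT THE PRIME `q = p` ITSELF, read in some field `𝔽` of characteristic `p` through `π : ℤ/p →+* 𝔽` —
`IsStabilisedLevelLoweringCongruenceIn W p 1 f p π`: there are `u ∈ 𝔽` and a `1`-periodic `φ : ℚ → 𝔽`, Hecke at every `ℓ ∤ N_E·p` with
eigenvalue `a_ℓ(E)`, with `[x]⁺_f ≡ u·(φ(x) − φ(p·x))` for ALL `x`.  In print's terms: `φ = Φ/Ω_g` reduced, `Φ` the plus symbol of the Ribet-lowered
`p`-new-to-`p`-old partner `g₁` (level `N/p`-part; `ρ̄` is finite flat at `p` because `¬ Surj ∧ Irr ∧ Mult` force `p ∣ v_p(Δ_min)`, and unramified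
at the other multiplicative primes by X11a's `¬ Ram`), `u` = the Greenberg–Vatsal unit times `1`, and `φ(x) − φ(p x)` = the plus symbol of the
`p`-stabilisation `g = g₁ − α_g⁻¹·g₁|V_p… ` normalised with `α_g ≡ a_p(f) = 1 (mod 𝔭)` — the exceptional-zero factor `(1 − α_g⁻¹)` is what makes
the `x = 0` value vanish.  Proof plan = steps (a)–(e) of K1 below (Ribet ∕ Diamond at `p`; Diamond–Taylor ∕ Coleman–Edixhoven stabilisation rows at
level exactly `N`; tree fact `greenbergVatsal2000_plusSymbol_congruence`, second bullet `p ∥ M`, `𝔪` ordinary; Ihara at the prime `p` in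
characteristic `p` = tree fact `ribet1984_iharaLemma`; all-`r` integrality `Additive.norm_ratPlusSymbol_le_one_of_irreducible` to pass from `Ω_f` to
`Ω⁺_f`); the `q ≠ p = 3` twin is the bsd-addord Theorem A `isStabilisedLevelLoweringCongruenceIn_of_symbolCongruence`.  Why it might fail: the
stabilisation rows at the ADDITIVE primes of `N` (X11a curves need not be semistable) with Condition 1, and Ihara ∕ freeness for an `𝔪` that is
simultaneously `p`-old and `p`-new at level `N` — the delicate steps; K1ᴸ is stronger than K1 (all `x`, Hecke structure) but is exactly what print's
mechanism delivers.  [cite: GreenbergVatsal2000, §3 (17)–(19), Prop. 3.1, Rem. 3.4, Lemma 3.6] [cite: Vatsal1999, (1.6), Thm. 1.13]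
[cite: Diamond1995RefinedSerre, Thm. 1.1] [cite: Ribet1984, Thm. 4.1] [cite: ColemanEdixhoven1998, Thm. 4.1] -/
def LevelLoweringAtSplitP : Prop :=
  ∀ (W : WeierstrassCurve ℚ) [W.IsElliptic] [W.IsGloballyMinimal] (p : ℕ) [Fact p.Prime]
    {N : ℕ} [NeZero N] (f : CuspForm (Gamma0 N) 2),
    ClassX11a W p → ¬ Surj W p → 5 ≤ p → W.HasSplitMultiplicativeReductionAtPrime p →
    IsNewformOf W f →
    ∃ (𝔽 : Type) (_ : Field 𝔽) (π : ZMod (p ^ 1) →+* 𝔽), IsStabilisedLevelLoweringCongruenceIn W p 1 f p π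

/-- **K1 — `ExcSymbolZero` (ASIDE since REV 3: the value form on the FULL split locus; PROVED from K1ᴸ below; implies the key K1♭ trivially).**  For minimal `E/ℚ` in class X11a at a prime `p ≥ 5` of SPLIT multiplicative
reduction with `ρ̄_{E,p}` not surjective, and `f` the newform of `E`: `ord_p [0]⁺_f ≥ 1`, i.e. `p ∣ L(E,1)/Ω⁺_f` («the residual plus symbol
vanishes at the cusp `0` at an anomalous-split level-lowering prime»).  Proof plan (the `q = p` twin of the bsd-addord machine
`isStabilisedLevelLoweringCongruenceIn_of_symbolCongruence`): (a) `¬ Surj` + `Irr` + `Mult` ⟹ `p ∣ v_p(Δ_min)`, `E[p]` finite flat at `p`,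
and X11a's `¬ Ram` ⟹ `ρ̄` unramified at every other multiplicative prime; (b) Ribet ∕ Diamond (`diamond1995_refinedSerre`) ⟹ a newform `g₀`
of level `M₀ ∣ N/p`, `p ∤ M₀`, `ρ̄_{g₀} ≅ E[p]`, good ORDINARY at `p` (`a_p(g₀) ≡ 1 + 0`), hence `p`-distinguished; (c) stabilisation rows
(Diamond–Taylor non-optimal levels; Coleman–Edixhoven: `U_p` semisimple on `p`-old weight-2 forms) ⟹ a normalised eigenform `g` of level
EXACTLY `N`, `p`-old with `U_p g = α_g g`, `α_g ≡ 1 (mod 𝔭)`, congruent to `f` for ALL `n`, both with Condition 1; (d) the tree fact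
`greenbergVatsal2000_plusSymbol_congruence` (multiplicative `p`, `p ∥ M = N`, `𝔪` ordinary as `a_p(f) = 1`) ⟹ canonical periods with
`v(ι⁻¹([x]⁺_f/Ω_f − [x]⁺_g/Ω_g)) < 1` for all `x` and `[x₀]⁺_f/Ω_f` a unit for some `x₀`; (e) `p`-old shape `[x]⁺_g = Φ(x) − α_g⁻¹Φ(p x)` with
`Φ = [·]⁺_{g₁}`, `g₁` = `g` un-stabilised at `p`, and `Φ/Ω_g` integral (Ihara at the prime `p` in residue characteristic `p`, weight 2:
tree fact `ribet1984_iharaLemma`, no restriction on the characteristic; multiplicity one) ⟹ `v([0]⁺_g/Ω_g) ≥ v(1 − α_g⁻¹) > 0` ⟹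
`v([0]⁺_f/Ω_f) > 0`; (f) `Ω_f/Ω⁺_f` is `p`-integral because every `[r]⁺_f = [r]_f/Ω⁺_f` is (`Additive.norm_ratPlusSymbol_le_one_of_irreducible`)
and `[x₀]⁺_f/Ω_f` is a unit ⟹ `v([0]⁺_f) > 0`, i.e. `1 ≤ ord_p [0]⁺_f` (rational).  Why it might fail: step (c) at additive primes of `N`
(X11a curves need not be semistable: `6480 = 2⁴·3⁴·5`) needs `U_ℓ`-eigen stabilisations with eigenvalue `≡ a_ℓ(f) = 0` and Condition 1, and
step (e)'s integrality of `Φ/Ω_g` is an Ihara ∕ freeness statement for the `𝔪`-part at level `N` where `𝔪` is simultaneously `p`-old and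
`p`-new — the delicate point; BSD predicts K1 (`ord_p (L/Ω) = ord_p ∏ c + ord_p #Ш ≥ ord_p c_p ≥ 1`) and the census agrees (23/23 C_exc pairs
at `p = 5`, `N < 5·10⁵`: `ord₅ (L/Ω) ≥ 1`).  [cite: GreenbergVatsal2000, §3 (17)–(19), Prop. 3.1, Rem. 3.4] [cite: Vatsal1999, (1.6), Thm. 1.13]
[cite: Diamond1995RefinedSerre, Thm. 1.1] [cite: Ribet1984, Thm. 4.1] [cite: ColemanEdixhoven1998, Thm. 4.1] -/
def ExcSymbolZero : Prop :=
  ∀ (W : WeierstrassCurve ℚ) [W.IsElliptic] [W.IsGloballyMinimal] (p : ℕ) [Fact p.Prime]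
    {N : ℕ} [NeZero N] (f : CuspForm (Gamma0 N) 2),
    ClassX11a W p → ¬ Surj W p → 5 ≤ p → W.HasSplitMultiplicativeReductionAtPrime p →
    IsNewformOf W f → 1 ≤ padicValRat p (ratPlusSymbol f 0)

/-- **K1♭ — `ShallowExcSymbolZero` (THE KEY STUB since REV 3; label «research-S/M: COMPOSITE OF NAMED PRINT», no longer «beyond print»).**
K1 restricted to the SHALLOW Tamagawa locus `ord_p ∏ c_ℓ ≤ 1` — the only locus the line needs it on (EXC-SHALLOW; the deep and `Ш[p] ≠ 0`
exceptional pairs are routed to the residual cores C_tam^± ∕ C_exp^±).  For minimal `E/ℚ` in class X11a, `p ≥ 5` SPLIT multiplicative, `ρ̄_{E,p}` not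
surjective, `ord_p ∏ c ≤ 1`, `f` the newform of `E`: `1 ≤ ord_p [0]⁺_f` (`p ∣ L(E,1)/Ω⁺_f`).  PROOF PLAN S1′ (the critic's sign-flip sharpening S1 of
V#132, refined: lower at `p` AND at every other multiplicative prime, so that Ribet's OPTIMAL level suffices and the Ihara ∕ `Φ/Ω_g`-integrality step
(e) of K1 and every Steinberg-sign caveat disappear):
(i) LOCUS.  `¬ Surj ∧ Irr ∧ p ≥ 5` ⟹ no transvection in the image ⟹ `ρ̄` peu ramifié at `p`, `p ∣ v_p(Δ_min) = c_p` (so `ord_p c_p ≥ 1`); hence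
`ord_p ∏ c ≤ 1` forces `p ∤ c_ℓ` for `ℓ ≠ p`, and X11a's `¬ Ram` (`p ∣ v_ℓ(Δ)` at every other multiplicative `ℓ`) then forces every other
multiplicative prime to be NON-SPLIT (`c_ℓ ∈ {1,2}`; split would give `c_ℓ = v_ℓ(Δ)`, `p ∣ c_ℓ`) and `ρ̄` unramified there; at additive `ℓ` the
conductor exponent of `ρ̄` is that of `E` (`p ≥ 5`: the inertia image has order prime to `p`).  So `N(ρ̄) = N_add`, the additive part of `N`.
(ii) RIBET at the optimal level: a newform `g₀ ∈ S₂(Γ₀(N(ρ̄)))` with `ρ̄_{g₀} ≅ E[p]` (weight `2` since finite flat at `p`).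
(iii) SIGN FLIP (critic S1): `w(E) = +1` (`L(E,1) ≠ 0`); `w_p(E) = −a_p = −1` (split) while `g₀` is unramified at `p`; at the dropped non-split `ℓ`,
`w_ℓ(E) = −a_ℓ = +1`; at additive `ℓ` and `∞` the local signs of `g₀` and `E` agree (congruent local representations with equal conductor
exponent: local constants modulo `𝔭`, values `±` a power of `ℓ`, `p` odd — or Atkin–Lehner eigenvalues of `𝔭`-congruent eigenforms at the same
level) ⟹ `w(g₀) = −1` ⟹ `L(g₀,1) = 0` (functional equation) ⟹ `{0,∞}_{g₀} = 0`.
(iv) STABILISE back to level `N`: `g := g₀ ∣ ∏_q (1 − γ̃_q V_q)` over `q = p` (unit root `γ_p ≡ 1 = a_p(E)`: the unramified quotient of `ρ̄|G_p`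
is trivial, `ε̄` being ramified) and the dropped `ℓ` (`γ_ℓ ≡ −1 = a_ℓ(E)`, roots of `X² + (1+ℓ)X + ℓ ≡ (X+1)(X+ℓ)`); `g ∈ S₂(Γ₀(N))` is a normalised
eigenform for the full Hecke algebra with `p`-integral number-field coefficients, `aₙ(g) ≡ aₙ(f)` for ALL `n`, Condition 1 in characteristic `0`
(strong multiplicity one + `γ_q ≠ γ̃_q`, Coleman–Edixhoven: `a_q(g₀)² ≠ 4q` in weight `2`), and `[0]_g = ∏_q (1 − γ̃_q/q)·[0]_{g₀} = 0` EXACTLY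
(`∫₀^{i∞} h(qz) dz = q⁻¹ ∫₀^{i∞} h`).
(v) the TREE FACT `greenbergVatsal2000_plusSymbol_congruence` (`M = N`, `p ∥ N`, `E` multiplicative at `p`, `U_p f = f`, Condition 1 for the newform
`f`): canonical periods with `v(ι⁻¹([0]_f/Ω_f − [0]_g/Ω_g)) < 1`, i.e. `[0]_f/Ω_f ∈ 𝔪`, and `[x₁]_f/Ω_f` a unit for some `x₁`.
(vi) PERIOD TRANSFER = Step 1 of the landed `isStabilisedLevelLoweringCongruenceIn_of_symbolCongruence` (`p = 3` there, verbatim at any odd `p`):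
`κ = Ω_f/Ω⁺_f` is `p`-integral (unit symbol + `Additive.norm_ratPlusSymbol_le_one_of_irreducible`), `[0]⁺_f = κ·[0]_f/Ω_f ∈ 𝔪`, rational ⟹
`1 ≤ ord_p [0]⁺_f`.  Why it might fail: only transcription risk — the equal-conductor hypothesis of the local-constant congruence at additive
primes in (iii) (granted by (i)) and the Condition-1 ∕ integrality binders of the tree fact for the multiply-stabilised `g` in (iv); no step is a
research statement.  Instrument (critic, V#132, Cremona `N < 5·10⁵`, `p = 5`): at the fully lowered level `N/(p·∏ℓ)` the rational partner has
ODD rank on every shallow pair where one was found (13/13) and EVEN rank on the 2 deep pairs — exactly (iii).  BSD predicts K1♭.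
[cite: Serre1987, §2.8 and §4] [cite: Ribet1990, Thm. 1.1] [cite: Carayol1989, Thm.] [cite: Deligne1973Constantes, §6]
[cite: ColemanEdixhoven1998, Thm. 4.1] [cite: GreenbergVatsal2000, §3 (17)–(19), Prop. 3.1, Rem. 3.4] [cite: Vatsal1999, (1.6), Thm. 1.13]
[cite: Mazur1978, Cor. 4.1] -/
def ShallowExcSymbolZero : Prop :=
  ∀ (W : WeierstrassCurve ℚ) [W.IsElliptic] [W.IsGloballyMinimal] (p : ℕ) [Fact p.Prime]
    {N : ℕ} [NeZero N] (f : CuspForm (Gamma0 N) 2),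
    ClassX11a W p → ¬ Surj W p → 5 ≤ p → W.HasSplitMultiplicativeReductionAtPrime p →
    padicValNat p W.tamagawaProduct ≤ 1 → IsNewformOf W f → 1 ≤ padicValRat p (ratPlusSymbol f 0)

/-- **K1♯ `VanishingPartnerAtSplitP` — THE KEY STUB since REV 4: the S1′ partner, in the binder currency of the tree fact
`greenbergVatsal2000_plusSymbol_congruence` and of the LEAD's landed core `Theorems.GL1Cartan.Exc.one_le_padicValRat_ratPlusSymbol_zero_of_symbolCongruence`.**
On the shallow anomalous-split locus (X11a, `¬ Surj`, `5 ≤ p`, `p` split, `ord_p ∏ c ≤ 1`), for the newform `f` of `W` at level `N`: there are a field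
isomorphism `ι : ℚ̄_p ≃ ℂ` and a form `g ∈ S₂(Γ₀(N))` — a normalised Hecke eigenform with number-field, `ι`-integral coefficients satisfying Vatsal's
Condition 1 in characteristic `0` — congruent to `f` at EVERY index (`v(ι⁻¹(aₙ(f) − aₙ(g))) < 1` for all `n`) whose plus modular symbol VANISHES AT THE
CUSP `0`: `plusSymbol g 0 = 0`.  Plan S1′ (i)–(iv): `g` = the full stabilisation back to level `N` (`γ_p ≡ 1`, `γ_ℓ ≡ −1` at the other multiplicative
`ℓ`, all unramified and non-split on the locus) of Ribet's optimal-level newform `g₀` of `ρ̄_{E,p}`, which has root number `−w(E) = −1`, so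
`L(g₀,1) = 0` and `plusSymbol g 0 = (∏_q (1 − γ̃_q/q))·(normalised L(g₀,1)) = 0` EXACTLY.  K1♭ FOLLOWS (real proof `shallowExcSymbolZero_of_vanishingPartner`
below: GV by name + the lead's core with the degenerate old-shape `q = 0`, `c = 1`, `Φ = plusSymbol g`).  Label: research-S/M, composite of named print
(Serre 1987 §2.8/§4 · Ribet 1990 Thm 1.1 · Atkin–Lehner/Deligne local signs under congruence · Coleman–Edixhoven 1998 · strong multiplicity one).
Why it might fail: transcription only — Condition 1 (`HasSimpleHeckeGenEigenspace`, characteristic 0) for the multiply-stabilised `g` needs the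
stabilisation roots distinct (`a_q(g₀)² ≠ 4q`, CE98 in weight 2), and the all-`n` congruence at additive primes needs equal conductor exponents of `ρ̄`
and `E` there (`p ≥ 5`).  [cite: Ribet1990, Thm. 1.1] [cite: Serre1987, §2.8 and §4] [cite: ColemanEdixhoven1998, Thm. 4.1]
[cite: Deligne1973Constantes, §6] [cite: GreenbergVatsal2000, §3 (17)–(19)] -/
def VanishingPartnerAtSplitP : Prop :=
  ∀ (W : WeierstrassCurve ℚ) [W.IsElliptic] [W.IsGloballyMinimal] (p : ℕ) [Fact p.Prime]
    {N : ℕ} [NeZero N] (f : CuspForm (Gamma0 N) 2),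
    ClassX11a W p → ¬ Surj W p → 5 ≤ p → W.HasSplitMultiplicativeReductionAtPrime p →
    padicValNat p W.tamagawaProduct ≤ 1 → IsNewformOf W f →
    ∃ (ι : PadicAlgCl p ≃+* ℂ) (g : CuspForm (Gamma0 N) 2),
      IsHeckeEigenform g ∧ IsNormalized g ∧ FiniteDimensional ℚ (coeffField g) ∧
      (∀ n : ℕ, Valued.v (ι.symm (cuspCoeff g n)) ≤ 1) ∧ HasSimpleHeckeGenEigenspace g ∧
      (∀ n : ℕ, Valued.v (ι.symm (cuspCoeff f n - cuspCoeff g n)) < 1) ∧ plusSymbol g 0 = 0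

/-- **V♭ — shallow exceptional Tamagawa divisibility in the record's currency (PROVED from K1♭ below, not a stub).**  On X11a, `¬ Surj`, `5 ≤ p`, `p` split,
`ord_p ∏ c ≤ 1`: every rational `t` with `L(E,1)/Ω_E = t` has `1 ≤ ord_p t` (the `q = p` twin of the record's `one_le_padicValRat_LOne_div_of_exists_split`,
which needs `p` NON-split and eight Kato facts). [cite: GreenbergVatsal2000, §3 Rem. 3.4] [cite: Mazur1978, Cor. 4.1] -/
def ShallowExcValueDivisibility : Prop :=
  ∀ (W : WeierstrassCurve ℚ) [W.IsElliptic] [W.IsGloballyMinimal] (p : ℕ) [Fact p.Prime],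
    ClassX11a W p → ¬ Surj W p → 5 ≤ p → W.HasSplitMultiplicativeReductionAtPrime p →
    padicValNat p W.tamagawaProduct ≤ 1 →
    ∀ t : ℚ, W.entireLFunction 1 / (W.realPeriodRat : ℂ) = (t : ℂ) → 1 ≤ padicValRat p t

/-- **EXC-SHALLOW — the exceptional shallow sector (PROVED from V♭ + three prints below, not a stub; since REV 3 closed modulo K1♭ = named print).**  U5 on «X11a, `¬ Surj`, `5 ≤ p`, `p` SPLIT
multiplicative, `ord_p ∏ c_ℓ ≤ 1`, `Ш(E)[p] = 0`» (21 of the 23 C_exc census pairs at `p = 5`). [cite: Miller2011LMS, Def. 1.1]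
[cite: SilvermanATAEC1994, Cor. IV.9.2 (d)] -/
def ExcShallowSector : Prop :=
  ∀ (W : WeierstrassCurve ℚ) [W.IsElliptic] [W.IsGloballyMinimal] (p : ℕ) [Fact p.Prime],
    ClassX11a W p → ¬ Surj W p → 5 ≤ p → W.HasSplitMultiplicativeReductionAtPrime p →
    padicValNat p W.tamagawaProduct ≤ 1 → (∀ x : W.sha, (p : ℤ) • x = 0 → x = 0) → MissingUpperBoundAt W p

/-- **C_exp^± — the `p`-type-free EXPONENT core (residual; U5 verbatim, restricted; datum-free; REV 3 typing `ExponentCoreR`).**  U5 on «X11a,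
`¬ Surj`, `5 ≤ p`, `Ш(E)[p] ≠ 0`» for BOTH `p`-types, with the record's hard-value clause «`L(E,1)/Ω_E` of non-zero valuation» asked ONLY at
non-split `p` (the record's C_exp verbatim there; at split `p` no value datum is assumed, as in the record's C_exc).  The common Euler-system wall (`EulerSystemBigImageAtSmallImage`); census at `p = 5`: the 15 main-locus twist pairs only.
[cite: Kato2004Asterisque, §17.13] [cite: Rubin2000EulerSystems, Thm. 2.2.10] -/
def ExponentCoreR : Prop :=
  ∀ (W : WeierstrassCurve ℚ) [W.IsElliptic] [W.IsGloballyMinimal] (p : ℕ) [Fact p.Prime],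
    ClassX11a W p → ¬ Surj W p → 5 ≤ p →
    (∃ x : W.sha, (p : ℤ) • x = 0 ∧ x ≠ 0) →
    (¬ W.HasSplitMultiplicativeReductionAtPrime p →
      ∀ t : ℚ, W.entireLFunction 1 / (W.realPeriodRat : ℂ) = (t : ℂ) → padicValRat p t ≠ 0) →
    MissingUpperBoundAt W p

/-- **C_tam^± — the `p`-type-free DEEP TAMAGAWA core (residual; U5 verbatim, restricted; datum-free; REV 3 typing `DeepTamagawaCoreR`).**  U5 on
«X11a, `¬ Surj`, `5 ≤ p`, `ord_p ∏ c_ℓ ≥ 2`, `Ш(E)[p] = 0`» for BOTH `p`-types, hard-value clause asked only at non-split `p` («`p² ∣ ∏ c ⇒ p² ∣ L(E,1)/Ω_E`»: a level-lowering congruence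
modulo `p²` ∕ at two primes — not in print; census at `p = 5`: the 2 split pairs `118080ds1`, `346560lh1`, none non-split).
[cite: Kato2004Asterisque, §17.13] [cite: SilvermanATAEC1994, Cor. IV.9.2 (d)] -/
def DeepTamagawaCoreR : Prop :=
  ∀ (W : WeierstrassCurve ℚ) [W.IsElliptic] [W.IsGloballyMinimal] (p : ℕ) [Fact p.Prime],
    ClassX11a W p → ¬ Surj W p → 5 ≤ p →
    2 ≤ padicValNat p W.tamagawaProduct → (∀ x : W.sha, (p : ℤ) • x = 0 → x = 0) →
    (¬ W.HasSplitMultiplicativeReductionAtPrime p →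
      ∀ t : ℚ, W.entireLFunction 1 / (W.realPeriodRat : ℂ) = (t : ℂ) → padicValRat p t ≠ 0) →
    MissingUpperBoundAt W p

/-- **The nine print-exact named facts of the record's glue (one conjunction, BY NAME; verbatim «sqparity5»'s `NineFacts`).**
[cite: SteinWuthrich2013, Thm. 6.1] [cite: Kato2004Asterisque, Thm. 12.4 and §17.13] [cite: Mazur1978, Cor. 4.1] [cite: Kolyvagin1990, Thm.] -/
def NineFacts : Prop :=
  Literature.NumberTheory.EllipticCurves.SteinWuthrich2013.thm61_splitMultiplicative ∧
    Literature.NumberTheory.EllipticCurves.SteinWuthrich2013.thm61_nonsplitMultiplicative ∧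
    Literature.NumberTheory.EllipticCurves.Kato2004.thm12_4 ∧
    Literature.NumberTheory.EllipticCurves.ModularForms.exists_isNewformOf ∧
    Literature.NumberTheory.EllipticCurves.Kato2004.exists_multDivisibilityInputs_nonsplit_contra ∧
    Literature.NumberTheory.EllipticCurves.Kato2004.exists_multDivisibilityInputs_split_contra ∧
    Literature.NumberTheory.EllipticCurves.Kato2004.exists_multDivisibilityInputs_fine_contra ∧
    Literature.NumberTheory.EllipticCurves.ModularForms.mazur_not_dvd_maninConstant_of_odd ∧
    rank_eq_analyticRank_of_analyticRank_le_one

/-! ## §2 Stubs (5; `sorry` only here: nine facts + GV by name, K1♯, C_exp^±, C_tam^±) -/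

/-- stub N (PRINT INPUTS BY NAME): the nine facts. [cite: SteinWuthrich2013, Thm. 6.1] [cite: Kato2004Asterisque, Thm. 12.4] -/
theorem stub_nineFacts : NineFacts := by
  sorry

/-- stub GV (PRINT INPUT BY NAME, as in the lead's road): Greenberg–Vatsal 2000 §3 (17)–(19) ∕ Vatsal 1999 Thm. (1.13), second bullet (`p ∥ N`).
[cite: GreenbergVatsal2000, §3 (17)–(19)] [cite: Vatsal1999, Thm. 1.13] -/
theorem stub_greenbergVatsal : greenbergVatsal2000_plusSymbol_congruence := by
  sorry

/-- stub K1♯ (KEY since REV 4; research-S/M: composite of named print via S1′ (i)–(iv) — Serre ∕ Ribet optimal level ∕ sign flip ∕ stabilisation +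
Condition 1 in characteristic 0): the vanishing partner at an anomalous-split level-lowering prime, on the shallow Tamagawa locus.
[cite: Ribet1990, Thm. 1.1] [cite: Serre1987, §2.8 and §4] [cite: ColemanEdixhoven1998, Thm. 4.1] -/
theorem stub_vanishingPartnerAtSplitP : VanishingPartnerAtSplitP := by
  sorry

/-- stub C_exp^± (residual; U5 verbatim on «`Ш[p] ≠ 0`, hard value», both `p`-types). [cite: Kato2004Asterisque, §17.13] -/
theorem stub_exponentCoreR : ExponentCoreR := by
  sorry

/-- stub C_tam^± (residual; U5 verbatim on «`Ш[p] = 0`, `ord_p ∏ c ≥ 2`, hard value», both `p`-types). [cite: Kato2004Asterisque, §17.13] -/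
theorem stub_deepTamagawaCoreR : DeepTamagawaCoreR := by
  sorry

/-! ## §3 Real proofs -/

/-- **K1♭ from K1♯ and Greenberg–Vatsal BY NAME (real proof, REV 4) — S1′ (v)–(vi) kernel-checked through the LEAD's landed core.**
Given the vanishing partner `g` of K1♯: the GV fact (called exactly as in `Theorems.GL1Cartan.Exc.one_le_padicValRat_ratPlusSymbol_zero_of_greenbergVatsal`,
with `5 ≤ N` from `p ∣ N`, `p² ∤ N` from `a_p(E) = 1 ≠ 0`, Condition 1 for `f` from `hasSimpleHeckeGenEigenspace_of_isNewform0`) hands canonical periods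
`Ω_f, Ω_g` with `[x]_f/Ω_f ≡ [x]_g/Ω_g (mod 𝔭)` for all `x` and an `f`-side unit point `x₁`; the `g`-side is then a unit at `x₁` too (ultrametric), and the
lead's core `one_le_padicValRat_ratPlusSymbol_zero_of_symbolCongruence` applies with the DEGENERATE old shape `q = 0`, `c = 1`, `Φ = plusSymbol g`, `Ω = Ω_g`
(legal because `plusSymbol g 0 = 0`: `Φ(x) − Φ(0·x) = plusSymbol g x`), giving `1 ≤ ord_p [0]⁺_f` once `[0]⁺_f ≠ 0` — which holds since `L(E,1) ≠ 0`
(`r_an = 0`, `L` entire by the newform) and `L(E,1) = [0]⁺_f·Ω⁺_f`.  The all-`r` integrality input is `Additive.forall_padicValRat_ratPlusSymbol_nonneg_of_irreducible`.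
[cite: GreenbergVatsal2000, §3 (17)–(19)] [cite: Vatsal1999, §1 (1.6), Remark (1.12), Thm. (1.13)] [cite: Mazur1978, Cor. 4.1] -/
theorem shallowExcSymbolZero_of_vanishingPartner (hGV : greenbergVatsal2000_plusSymbol_congruence)
    (hV : VanishingPartnerAtSplitP) : ShallowExcSymbolZero := by
  intro W _ _ p _ N _ f hX hns hp5 hsp htam hf
  obtain ⟨ι, g, hg, hg1, hgK, hgint, hgC, hcong, hg0⟩ := hV W p f hX hns hp5 hsp htam hf
  have hp : p.Prime := Fact.out
  have hp2 : p ≠ 2 := by omega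
  have hmult : W.HasMultiplicativeReductionAtPrime p := hX.mult
  -- level bookkeeping: `p ∣ N`, `5 ≤ N`, `p² ∤ N`
  have hpN1 : p ∣ N := (hf.dvd_level_iff_dvd_conductorNorm hp).mpr
    ((W.dvd_conductorNorm_iff_not_hasGoodReductionAtPrime p).mpr
      (WeierstrassCurve.HasMultiplicativeReduction.not_hasGoodReduction (hW := hmult)))
  have h5 : 5 ≤ N := le_trans hp5 (Nat.le_of_dvd (Nat.pos_of_ne_zero (NeZero.ne N)) hpN1)
  have hap : W.LFunction p = 1 := W.LFunction_apply_prime_of_hasSplitMultiplicativeReductionAtPrime p hsp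
  have hpN : ¬ p ^ 2 ∣ N := hf.not_sq_dvd_level_of_lFunction_ne_zero hp (by rw [hap]; exact one_ne_zero)
  have hint : ∀ r : ℚ, ratPlusSymbol f r ≠ 0 → 0 ≤ padicValRat p (ratPlusSymbol f r) :=
    Summit.BirchSwinnertonDyer.Rank1Residual.Additive.forall_padicValRat_ratPlusSymbol_nonneg_of_irreducible hp2 hf hX.irr
  -- `[0]⁺_f ≠ 0` from `r_an = 0`
  have hL : W.HasEntireLFunction := W.hasEntireLFunction_of_cuspCoeff_eq (strictWidthInfty_Gamma0 _) f hf.2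
  have hL1 : W.entireLFunction 1 ≠ 0 := (W.analyticRank_eq_zero_iff_holds hL).mp hX.analyticRank_eq_zero
  have h0 : ratPlusSymbol f 0 ≠ 0 := by
    intro h0
    apply hL1
    rw [hf.entireLFunction_one_eq, h0]
    simp
  -- Greenberg–Vatsal by name, called as in the lead's wrapper
  have hfC : HasSimpleHeckeGenEigenspace f :=
    Theorems.KimAtThreeDeepLowerOffStratumLevelLoweringConditionOne.hasSimpleHeckeGenEigenspace_of_isNewform0 hf.1
  obtain ⟨Ωf, Ωg, hΩf, hΩg, -, hψint, hcongr, x₁, hx₁⟩ :=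
    hGV p N N ι W f f g hp2 h5 dvd_rfl hpN (Or.inr hmult) hX.irr hf hf.1.2.1 hf.1.2.2
      (Theorems.KimAtThreeDeepLowerOffStratumLevelLoweringVatsalRows.finiteDimensional_coeffField_of_isNewformOf W hf)
      (Theorems.GL1Cartan.Exc.valuation_cuspCoeff_le_one_of_isNewformOf hf ι) hfC
      (fun n _ => hf.2 n) (fun _ => Theorems.GL1Cartan.Exc.valuation_cuspCoeff_eq_one_of_mult ι W hf hmult) hg hg1 hgK hgint hgC hcong
  -- the `g`-side normalised symbol is a unit at the `f`-side unit point `x₁` (ultrametric)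
  have hgx₁ : Valued.v (ι.symm (plusSymbol g x₁ / Ωg)) = 1 := by
    have heq : ι.symm (plusSymbol g x₁ / Ωg) =
        ι.symm (plusSymbol f x₁ / Ωf) + -ι.symm (plusSymbol f x₁ / Ωf - plusSymbol g x₁ / Ωg) := by
      rw [← map_neg, ← map_add]; congr 1; ring
    have hlt : Valued.v (-ι.symm (plusSymbol f x₁ / Ωf - plusSymbol g x₁ / Ωg)) <
        Valued.v (ι.symm (plusSymbol f x₁ / Ωf)) := by
      rw [Valuation.map_neg, hx₁]; exact hcongr x₁
    rw [heq, Valuation.map_add_eq_of_lt_left _ hlt, hx₁]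
  -- the lead's core with the degenerate old shape `q = 0`, `c = 1`, `Φ = plusSymbol g`, `Ω = Ω_g`
  refine Theorems.GL1Cartan.Exc.one_le_padicValRat_ratPlusSymbol_zero_of_symbolCongruence W hf ι hint hΩf hΩg hψint hcongr
    ⟨x₁, hx₁⟩ 0 (plusSymbol g) 1 (fun x => ?_) (by simp) (Ω := Ωg) hψint ⟨x₁, ?_⟩ h0
  · simp [hg0]
  · simpa [hg0] using hgx₁


/-- **K1 from K1ᴸ (real proof; REV 2; ASIDE road since REV 3).**  Read (LL₁) at `q = p` AT THE CUSP `x = 0`: `φ(0) − φ(p·0) = 0`, so `π([0]⁺_f mod p) = 0`; `π` is injective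
(`ℤ/p` is a field), `[0]⁺_f` is `p`-integral (`Additive.norm_ratPlusSymbol_le_one_of_irreducible`) and non-zero (`L(E,1) ≠ 0` on X11a), and
`ratModP p = toZModPow 1` on `p`-integral rationals with kernel `(p)`: hence `‖[0]⁺_f‖_p ≤ p⁻¹`, i.e. `1 ≤ ord_p [0]⁺_f`.  Bookkeeping around
[cite: GreenbergVatsal2000, §3 display (18)–(19)]. -/
theorem excSymbolZero_of_levelLowering (hnf : exists_isNewformOf) (hL : LevelLoweringAtSplitP) : ExcSymbolZero := by
  intro W _ _ p _ N _ f hX hns hp5 hsp hf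
  obtain ⟨𝔽, _, π, u, φ, hper, hH, hC⟩ := hL W p f hX hns hp5 hsp hf
  have hp2 : p ≠ 2 := by omega
  have hpr : p.Prime := Fact.out
  -- the stabilisation factor kills the value at the cusp 0
  have h0 : π (ratModP (p ^ 1) (ratPlusSymbol f 0)) = 0 := by simpa using hC 0
  -- π is injective: ℤ/p^1 ≅ ℤ/p is a field
  have hinj : Function.Injective π := by
    let ψ : ZMod p ≃+* ZMod (p ^ 1) := ZMod.ringEquivCongr (pow_one p).symm
    have hi : Function.Injective (π.comp ψ.toRingHom) := (π.comp ψ.toRingHom).injective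
    intro a b hab
    have hab' : (π.comp ψ.toRingHom) (ψ.symm a) = (π.comp ψ.toRingHom) (ψ.symm b) := by simpa using hab
    simpa using congrArg ψ (hi hab')
  have hz : ratModP (p ^ 1) (ratPlusSymbol f 0) = 0 := hinj (by rw [h0, map_zero])
  -- integrality and non-vanishing of [0]⁺_f
  have hnorm : ‖((ratPlusSymbol f 0 : ℚ) : ℚ_[p])‖ ≤ 1 :=
    Summit.BirchSwinnertonDyer.Rank1Residual.Additive.norm_ratPlusSymbol_le_one_of_irreducible hp2 hf hX.irr 0
  have hden : ¬ p ∣ (ratPlusSymbol f 0).den :=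
    Literature.NumberTheory.EllipticCurves.not_dvd_den_of_norm_ratCast_le_one hnorm
  have hs0 : ratPlusSymbol f 0 ≠ 0 := fun h ↦
    (hX.L_one_ne_zero (WeierstrassCurve.hasEntireLFunction_rat_of_exists_isNewformOf hnf))
      (by rw [hf.entireLFunction_one_eq, h]; simp)
  -- ratModP (p^1) is toZModPow 1 on p-integral rationals; its kernel is (p)
  rw [Literature.NumberTheory.EllipticCurves.ratModP_eq_toZModPow p 1 hden] at hz
  set x : ℤ_[p] := ⟨((ratPlusSymbol f 0 : ℚ) : ℚ_[p]), Padic.norm_rat_le_one hden⟩ with hx_def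
  have hmem : x ∈ RingHom.ker (PadicInt.toZModPow (p := p) 1) := (RingHom.mem_ker).mpr hz
  rw [PadicInt.ker_toZModPow] at hmem
  have hxn := (PadicInt.norm_le_pow_iff_mem_span_pow x 1).mpr hmem
  have hxn' : ‖((ratPlusSymbol f 0 : ℚ) : ℚ_[p])‖ ≤ (p : ℝ) ^ (-(1 : ℕ) : ℤ) := by simpa [hx_def] using hxn
  have hq0 : ((ratPlusSymbol f 0 : ℚ) : ℚ_[p]) ≠ 0 := by exact_mod_cast hs0
  rw [Padic.norm_eq_zpow_neg_valuation hq0, Padic.valuation_ratCast] at hxn'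
  have hp1 : (1 : ℝ) < p := by exact_mod_cast hpr.one_lt
  have hmono := (zpow_le_zpow_iff_right₀ hp1).mp hxn'
  omega


/-- **K1 ⟹ V (CONDITIONAL on modularity `hnf` and Mazur Cor. 4.1 `hMz`).**  `L(E,1) = [0]⁺_f · Ω⁺_f` (`IsNewformOf.entireLFunction_one_eq`) and
`Ω_E = u · Ω⁺_f` with `|u|_p = 1` at the multiplicative `p ≥ 5` with `E[p]` irreducible
(`SkinnerUrban2014.realPeriodRat_eq_unit_mul_plusPeriod_of_multiplicative_of_mazur`), so `t = [0]⁺_f/u` and `ord_p t = ord_p [0]⁺_f ≥ 1`.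
[cite: GreenbergVatsal2000, §3 Rem. 3.4] [cite: Mazur1978, Cor. 4.1] [cite: MazurTateTeitelbaum1986, §I.8] -/
theorem shallowExcSymbolZero_of_excSymbolZero (hK : ExcSymbolZero) : ShallowExcSymbolZero :=
  fun W _ _ p _ _ _ f hX hns hp5 hsp _ hf => hK W p f hX hns hp5 hsp hf

/-- **K1♭ ⟹ V♭ (CONDITIONAL on modularity `hnf` and Mazur Cor. 4.1 `hMz`).**  `L(E,1) = [0]⁺_f · Ω⁺_f` (`IsNewformOf.entireLFunction_one_eq`) and
`Ω_E = u · Ω⁺_f` with `|u|_p = 1` at the multiplicative `p ≥ 5` with `E[p]` irreducible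
(`SkinnerUrban2014.realPeriodRat_eq_unit_mul_plusPeriod_of_multiplicative_of_mazur`), so `t = [0]⁺_f/u` and `ord_p t = ord_p [0]⁺_f ≥ 1`.
[cite: GreenbergVatsal2000, §3 Rem. 3.4] [cite: Mazur1978, Cor. 4.1] [cite: MazurTateTeitelbaum1986, §I.8] -/
theorem shallowExcValueDivisibility_of_symbolZero (hnf : exists_isNewformOf) (hMz : mazur_not_dvd_maninConstant_of_odd)
    (hK : ShallowExcSymbolZero) : ShallowExcValueDivisibility := by
  intro W _ _ p _ hX hns hp5 hsp htam t ht
  haveI : NeZero (W.conductorNorm ℤ) := ⟨(W.conductorNorm_pos_holds).ne'⟩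
  obtain ⟨f, hf⟩ := hnf W
  obtain ⟨u, hu, hΩ⟩ :=
    SkinnerUrban2014.realPeriodRat_eq_unit_mul_plusPeriod_of_multiplicative_of_mazur hMz W p hp5 hX.mult hX.irr f hf
  have hL1 : W.entireLFunction 1 ≠ 0 :=
    hX.L_one_ne_zero (WeierstrassCurve.hasEntireLFunction_rat_of_exists_isNewformOf hnf)
  have hΩpos : 0 < W.realPeriodRat := W.realPeriodRat_pos_holds
  have hΩC : (W.realPeriodRat : ℂ) ≠ 0 := Complex.ofReal_ne_zero.mpr hΩpos.ne'
  have hu0 : u ≠ 0 := by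
    rintro rfl
    rw [Rat.cast_zero, zero_mul] at hΩ
    exact hΩpos.ne' hΩ
  have hLval : W.entireLFunction 1 = ((((ratPlusSymbol f 0 : ℚ) : ℝ) * plusPeriod f : ℝ) : ℂ) :=
    hf.entireLFunction_one_eq
  have hplus : plusPeriod f = W.realPeriodRat / u := by
    rw [hΩ, mul_div_cancel_left₀ _ (Rat.cast_ne_zero.mpr hu0)]
  have ht' : W.entireLFunction 1 / (W.realPeriodRat : ℂ) = ((ratPlusSymbol f 0 / u : ℚ) : ℂ) := by
    rw [hLval, hplus, div_eq_iff hΩC]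
    push_cast
    have huC : ((u : ℝ) : ℂ) ≠ 0 := by exact_mod_cast hu0
    field_simp
  have htt : t = ratPlusSymbol f 0 / u := by exact_mod_cast ht.symm.trans ht'
  have hb0 : ratPlusSymbol f 0 ≠ 0 := by
    intro h0
    apply hL1
    rw [hLval, h0]
    simp
  rw [htt, padicValRat.div hb0 hu0, Rank1Residual.padicValRat_eq_zero_of_norm_ratCast_eq_one hu, sub_zero]
  exact hK W p f hX hns hp5 hsp htam hf

/-- **V♭ ⟹ EXC-SHALLOW (CONDITIONAL on GZK, modularity, Mazur Cor. 4.1)** — verbatim the record's SHALLOW argument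
(`missingUpperBoundAt_of_noPTorsion_of_shallowTamagawa`) with V in place of the eight-fact Tamagawa divisibility:
`ord_p #Ш_an = ord_p (L/Ω) − ord_p ∏ c ≥ 1 − 1 = 0` (`padicValRat_shaAn_eq_sub_tamagawa`) and the door `ClassX11a.missingUpperBoundAt_of_noPTorsion`.
[cite: SilvermanATAEC1994, Cor. IV.9.2 (d) and Table 4.1] [cite: Miller2011LMS, Def. 1.1 (arXiv:1010.2431 p. 3)] -/
theorem excShallowSector_of_valueDivisibility (hGZK : rank_eq_analyticRank_of_analyticRank_le_one)
    (hnf : exists_isNewformOf) (hMz : mazur_not_dvd_maninConstant_of_odd) (hV : ShallowExcValueDivisibility) :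
    ExcShallowSector := by
  intro W _ _ p _ hX hns hp5 hsp htam hSha
  obtain ⟨t, ht, ht0, -⟩ := hX.exists_LOne_div_realPeriod_eq_of_mazur hnf hMz hp5
  have hL1 : W.entireLFunction 1 ≠ 0 := by
    intro h0
    apply ht0
    have h : ((t : ℚ) : ℂ) = 0 := by rw [← ht, h0, zero_div]
    exact_mod_cast h
  obtain ⟨-, -, -, hsha⟩ := shaAn_eq_of_L_one_div_eq hGZK W hL1 ht
  have hvq := padicValRat_shaAn_eq_sub_tamagawa hGZK hnf hMz hX hp5 hsha ht
  refine hX.missingUpperBoundAt_of_noPTorsion hGZK hsha ?_ hSha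
  rw [hvq]
  have h1 : 1 ≤ padicValRat p t := hV W p hX hns hp5 hsp htam t ht
  have h2 : (padicValNat p W.tamagawaProduct : ℤ) ≤ 1 := by exact_mod_cast htam
  linarith

/-- **C_exc from the parts (fact-free): EXC-SHALLOW → C_exp^± → C_tam^± ⟹ the record's exceptional core `GL1Cartan.ExcZeroCoreResidual`
(unfolded).**  Case split on «`Ш(E)[p] = 0`» and «`ord_p ∏ c ≤ 1`»; at a split `p` the ± cores ask no value clause. [cite: Miller2011LMS, Def. 1.1] -/
theorem excZeroCore_of_parts (hS : ExcShallowSector) (hCx : ExponentCoreR) (hCt : DeepTamagawaCoreR) :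
    ∀ (W : WeierstrassCurve ℚ) [W.IsElliptic] [W.IsGloballyMinimal] (p : ℕ) [Fact p.Prime],
      ClassX11a W p → ¬ Surj W p → 5 ≤ p → W.HasSplitMultiplicativeReductionAtPrime p → MissingUpperBoundAt W p := by
  intro W _ _ p _ hX hns hp5 hsp
  by_cases hSha : ∀ x : W.sha, (p : ℤ) • x = 0 → x = 0
  · by_cases htam : padicValNat p W.tamagawaProduct ≤ 1
    · exact hS W p hX hns hp5 hsp htam hSha
    · exact hCt W p hX hns hp5 (by omega) hSha (fun h => absurd hsp h)
  · push Not at hSha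
    obtain ⟨x, hx, hx0⟩ := hSha
    exact hCx W p hX hns hp5 ⟨x, hx, hx0⟩ (fun h => absurd hsp h)

/-- **The line asks NO MORE of the future than rev 10 (fact-free): the record's three cores C_exc, C_exp, C_tam (unfolded) imply the two ± cores.**
[cite: Miller2011LMS, Def. 1.1] -/
theorem rCores_of_threeCores
    (hCe : ∀ (W : WeierstrassCurve ℚ) [W.IsElliptic] [W.IsGloballyMinimal] (p : ℕ) [Fact p.Prime],
      ClassX11a W p → ¬ Surj W p → 5 ≤ p → W.HasSplitMultiplicativeReductionAtPrime p → MissingUpperBoundAt W p)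
    (hCx : ∀ (W : WeierstrassCurve ℚ) [W.IsElliptic] [W.IsGloballyMinimal] (p : ℕ) [Fact p.Prime],
      ClassX11a W p → ¬ Surj W p → 5 ≤ p → ¬ W.HasSplitMultiplicativeReductionAtPrime p →
      (∃ x : W.sha, (p : ℤ) • x = 0 ∧ x ≠ 0) →
      (∀ t : ℚ, W.entireLFunction 1 / (W.realPeriodRat : ℂ) = (t : ℂ) → padicValRat p t ≠ 0) →
      MissingUpperBoundAt W p)
    (hCt : ∀ (W : WeierstrassCurve ℚ) [W.IsElliptic] [W.IsGloballyMinimal] (p : ℕ) [Fact p.Prime],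
      ClassX11a W p → ¬ Surj W p → 5 ≤ p → ¬ W.HasSplitMultiplicativeReductionAtPrime p →
      2 ≤ padicValNat p W.tamagawaProduct → (∀ x : W.sha, (p : ℤ) • x = 0 → x = 0) →
      (∀ t : ℚ, W.entireLFunction 1 / (W.realPeriodRat : ℂ) = (t : ℂ) → padicValRat p t ≠ 0) →
      MissingUpperBoundAt W p) :
    ExponentCoreR ∧ DeepTamagawaCoreR := by
  refine ⟨fun W _ _ p _ hX hns hp5 hSha hval => ?_, fun W _ _ p _ hX hns hp5 htam hSha hval => ?_⟩
  · by_cases hsp : W.HasSplitMultiplicativeReductionAtPrime p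
    · exact hCe W p hX hns hp5 hsp
    · exact hCx W p hX hns hp5 hsp hSha (hval hsp)
  · by_cases hsp : W.HasSplitMultiplicativeReductionAtPrime p
    · exact hCe W p hX hns hp5 hsp
    · exact hCt W p hX hns hp5 hsp htam hSha (hval hsp)

/-- **Each residual is U5 restricted (fact-free): U5 ⟹ EXC-SHALLOW ∧ C_exp^± ∧ C_tam^±.** [cite: Miller2011LMS, Def. 1.1] -/
theorem parts_of_upperNonSurjFive (h : Theses.PrintX11a.UpperNonSurjFive) :
    ExcShallowSector ∧ ExponentCoreR ∧ DeepTamagawaCoreR :=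
  ⟨fun W _ _ p _ hX hns hp5 _ _ _ => h W p hX hns hp5,
    fun W _ _ p _ hX hns hp5 _ _ => h W p hX hns hp5,
    fun W _ _ p _ hX hns hp5 _ _ _ => h W p hX hns hp5⟩

/-- **Composition from hypotheses**: the nine facts, K1 and the two ± cores give U5 BY NAME, through the landed rev-10 turnkey
`Theorems.GL1Cartan.upperNonSurjFive_of_nineFacts_of_threeCores` (UNIT and SHALLOW closed there modulo the nine facts; C_exc from
`excZeroCore_of_parts`; C_exp, C_tam as the non-split halves of the ± cores). [cite: Miller2011LMS, Def. 1.1] [cite: Kato2004Asterisque, §17.13] -/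
theorem UpperNonSurjFive_of_hyps (hN : NineFacts) (hK : ShallowExcSymbolZero) (hCx : ExponentCoreR) (hCt : DeepTamagawaCoreR) :
    Theses.PrintX11a.UpperNonSurjFive := by
  obtain ⟨hJs, hJn, h12, hnf, hns', hsp', hfine', hMz, hGZK⟩ := hN
  have hV : ShallowExcValueDivisibility := shallowExcValueDivisibility_of_symbolZero hnf hMz hK
  exact upperNonSurjFive_of_nineFacts_of_threeCores hJs hJn h12 hnf hns' hsp' hfine' hMz hGZK
    (excZeroCore_of_parts (excShallowSector_of_valueDivisibility hGZK hnf hMz hV) hCx hCt)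
    (fun W _ _ p _ hX hns hp5 _ hSha hval => hCx W p hX hns hp5 hSha fun _ => hval)
    (fun W _ _ p _ hX hns hp5 _ htam hSha hval => hCt W p hX hns hp5 htam hSha fun _ => hval)

/-- **The aside road (REV 2's key, kept kernel-visible): nine facts + K1ᴸ (LL₁ at `q = p`, all `x`) + the ± cores ⟹ U5.** [cite: Miller2011LMS, Def. 1.1] -/
theorem UpperNonSurjFive_of_hyps_LL (hN : NineFacts) (hL : LevelLoweringAtSplitP) (hCx : ExponentCoreR) (hCt : DeepTamagawaCoreR) :
    Theses.PrintX11a.UpperNonSurjFive :=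
  UpperNonSurjFive_of_hyps hN (shallowExcSymbolZero_of_excSymbolZero (excSymbolZero_of_levelLowering hN.2.2.2.1 hL)) hCx hCt

/-- **REV 4 road from hypotheses: nine facts + GV by name + K1♯ + the ± cores ⟹ U5** (K1♭ derived by `shallowExcSymbolZero_of_vanishingPartner`).
[cite: Miller2011LMS, Def. 1.1] [cite: GreenbergVatsal2000, §3 (17)–(19)] -/
theorem UpperNonSurjFive_of_hyps_partner (hN : NineFacts) (hGV : greenbergVatsal2000_plusSymbol_congruence) (hV : VanishingPartnerAtSplitP)
    (hCx : ExponentCoreR) (hCt : DeepTamagawaCoreR) : Theses.PrintX11a.UpperNonSurjFive :=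
  UpperNonSurjFive_of_hyps hN (shallowExcSymbolZero_of_vanishingPartner hGV hV) hCx hCt

/-- **Composition U5 — the crux BY NAME, stub-fed (real proof; `sorry` only inside the five stubs).** [cite: Miller2011LMS, Def. 1.1] -/
theorem UpperNonSurjFive_of_llzero : Theses.PrintX11a.UpperNonSurjFive :=
  UpperNonSurjFive_of_hyps_partner stub_nineFacts stub_greenbergVatsal stub_vanishingPartnerAtSplitP stub_exponentCoreR
    stub_deepTamagawaCoreR

end Summit.BirchSwinnertonDyer.BirchSwinnertonDyer.Cruxes.UpperNonSurjFive.LLZero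

end
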